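import Literature.NumberTheory.EllipticCurves.DivisionTowerH1VanishingOfHomothetyProofs
import Literature.NumberTheory.EllipticCurves.CastellaGrossiLeeSkinner2022.HowardDivisibilityAnyClassNumber
import Summits.BirchSwinnertonDyer.Rank1Residual.X9.LeafDischargeKolyvaginCebotarev
import HarnessLib

/-!
# Howard's hypothesis H.2 — `H¹(L/K, E(L)[p^j]) = 0` along `K ⊆ L ⊆ K_∞(E[p^∞])` — UNCONDITIONALLY on the
# frames of the shared μ-letter of rows 9/10 (CGLS 2022 Thm. 4.1.3 standing hypotheses + `(irr_ℚ)`)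

Cell `pub/bsd-print-x9`, width seat `bsd-line-x9-p1-w4` (g2) under LEAD `bsd-line-x9-p1` (crux of record
stmt-BirchSwinnertonDyer-27077 `PrintX9.HowardContainmentLightFramePinnedOfPrintSharp`; shared μ-item THE CUT v2
= L∃ `HeegnerMuPartStabilized.MuPartStabilizedCoherentPair`), `--supports` stmt-BirchSwinnertonDyer-27077.
THEOREMS ONLY (no definition, no named fact, no instance); nothing here asserts the μ-item.

The port of Howard's `Λ`-adic Kolyvagin-system bound (Compositio 140 (2004), Thm. 2.2.10 at `𝔮 = (T^m + p)`,
LEAD's PORT BLUEPRINT §3 (P-H)) needs Howard's abstract hypotheses H.0–H.5 for `T_pE` over `K`. H.1 is the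
tree theorem `CastellaGrossiLeeSkinner2022.Thm413Hypotheses.exists_forall_eq_zsmul_of_hasIrreducibleModPGaloisRep`
(p630891); H.2 in tower form is `LawsonWuthrich2016.subgroupResKer_geomTorsion_eq_bot_of_homothety[_layer]`
(p633556) MODULO one homothety `σ ∈ Γ_K`, `σ ≡ a` on `E[p]`, `p ∤ a − 1`. This file DISCHARGES that homothety on
every frame of the letter — `Thm413Hypotheses N W K p κ γ` (`p` odd, `K` imaginary quadratic with `p ∤ d_K`, Heegner
hypothesis for `N = N_E`) together with `(irr_ℚ)` — for EVERY odd `p` (row 9: `p ≥ 5`; row 10: `p = 3`), and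
composes:

* §1 `isUnramifiedIn_of_not_dvd_discr` — `p ∤ d_K` ⇒ every place `v ∋ p` of `𝓞 ℚ` is unramified in `K`
  (Dedekind's discriminant theorem, Mathlib `NumberField.not_dvd_discr_iff_isUnramifiedIn`, re-based from the
  places of `ℤ` to those of `𝓞 ℚ` exactly as the SPLIT sibling `X11b.isUnramifiedIn_of_ncard_primesOver_eq_two`).
* §2 `forall_isUnramifiedIn_or_hasGoodReductionAt_of_heegner_of_not_dvd_discr`,
  `forall_exists_absGaloisRestrict_smul_eq_of_heegner_of_not_dvd_discr` — on a Heegner frame with `p ∤ d_K`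
  (instead of file F's «`p` split»), `K ∩ ℚ(E[p]) = ℚ`: **`ρ̄_{E,p}(Γ_K) = ρ̄_{E,p}(Γ_ℚ)`** (Gross 1991 §9 «`D`
  prime to `Np`»; tree `JetchevIrreducibleCebotarev.forall_exists_absGaloisRestrict_smul_eq_of_unramified`).
* §3 `exists_smul_eq_zsmul_baseChange_of_heegner_of_not_dvd_discr` — with `(irr_ℚ)` and `p` odd, some `z ∈ Γ_K`
  acts on `E_K(K̄)[p]` as an integer scalar `a` with `p ∤ a − 1` (tree `…exists_smul_eq_smul_baseChange_of_irreducible`: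
  `−1` at surjective image or `p = 3`, Serre §2.6 otherwise); `exists_smul_eq_zsmul_of_thm413Hypotheses` — the same
  read off `Thm413Hypotheses`.
* §4 **`subgroupResKer_geomTorsion_eq_bot_of_thm413Hypotheses`** (+ `_ker`, `_prime` forms) — H.2 with NO residual
  hypothesis: for all `b m`, `j ≤ m + 1` and every open normal `U ⊴ Γ_K` with `Γ_{K(E[p^{m+1}])} ⊓ κ⁻¹(p^b ℤ_p) ≤ U`
  (`κ` the letter's own anticyclotomic `ℤ_p`-extension), `ker (H¹(Γ_K, E_K[p^j]) → H¹(U, E_K[p^j])) = 0`.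
* §5 `subgroupResKer_geomTorsion_eq_bot_of_classX9_heegner` — the same on the X9 LEAF frames of file F/G
  (`Rank1Residual.ClassX9 W p`, `K` imaginary quadratic, Heegner for `N_E`, `p` split), from ty2's
  `ClassX9.kolyvaginImage_scalar_of_heegner`.

Not here: H.3/H.4 (carrier-bound), the carrier `T_𝔮` itself, anything about the μ-inequality. «beyond-print theorem»:
no (Gross §9 + Serre §2.6 + Sah/Lawson–Wuthrich Lemma 3). BSD is NOT proved by this file; no summit statement is
proved by it.

References: B. Howard, Compositio Math. 140 (2004), §1.3/§2.3 hypothesis H.2, Lemma 2.6.2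
[Howard2004HeegnerKolyvagin]; T. Lawson, C. Wuthrich (2016), Lemma 3, Lemma 4 [LawsonWuthrich2016]; B. H. Gross,
LMS LN 153 (1991), §9 [GrossLMS1991]; J.-P. Serre, Invent. Math. 15 (1972), §2.6, §5.4 [Serre1972]; J. Neukirch,
*Algebraic Number Theory*, III (2.12) [NeukirchANT1999]; F. Castella, G. Grossi, J. Lee, C. Skinner, Invent. Math.
227 (2022), §3.2/§4.1 [CastellaGrossiLeeSkinner2022].
-/

-- the summit and its single problem are both named `BirchSwinnertonDyer` (registry layout D-0017)
set_option linter.dupNamespace false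
set_option autoImplicit false

noncomputable section

open scoped Classical Pointwise

universe u

open WeierstrassCurve NumberField IsDedekindDomain Ideal Field
  Literature.NumberTheory.GaloisRepresentations Literature.NumberTheory.EllipticCurves
  Summit.BirchSwinnertonDyer.BirchSwinnertonDyer.Theorems.JetchevIrreducibleCebotarev

namespace Summit.BirchSwinnertonDyer.BirchSwinnertonDyer.Theorems.HeegnerMuPartHowardH2

/-! ### §1 `p ∤ d_K` ⇒ `K` is unramified at the places of `𝓞 ℚ` above `p` -/

section Unramified

variable {K : Type u} [Field K] [NumberField K]

/-- **`p ∤ d_K` ⇒ `p` is unramified in `K`, on the places of `𝓞 ℚ`.** For a number field `K` and a rational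
prime `p` not dividing `discr K`, every finite place `v ∋ p` of `𝓞 ℚ` is unramified in `𝓞 K`. Dedekind's
discriminant theorem in Mathlib (`NumberField.not_dvd_discr_iff_isUnramifiedIn`, base `ℤ`) re-based to `𝓞 ℚ`:
both ramification indices of a prime `P ∣ p` of `𝓞 K` are the old index `sSup {n | p·𝓞 K ≤ P ^ n}` of the
extended ideal `v·𝓞 K = p·𝓞 K = (p)ℤ·𝓞 K`. [cite: NeukirchANT1999, Ch. III §2, Cor. (2.12)] -/
theorem isUnramifiedIn_of_not_dvd_discr {p : ℕ} (hp : p.Prime) (hnd : ¬ (p : ℤ) ∣ NumberField.discr K) :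
    ∀ v : HeightOneSpectrum (𝓞 ℚ), (p : 𝓞 ℚ) ∈ v.asIdeal →
      Algebra.IsUnramifiedIn (𝓞 K) v.asIdeal := by
  have hp' : Prime (p : ℤ) := Nat.prime_iff_prime_int.mp hp
  have hZ : Algebra.IsUnramifiedIn (𝓞 K) (span {(p : ℤ)}) :=
    (NumberField.not_dvd_discr_iff_isUnramifiedIn K (𝓞 K) hp').mp hnd
  intro v hpv
  rw [Algebra.isUnramifiedIn_iff_forall_ramificationIdx_eq_one] at hZ ⊢
  intro P _ hP
  -- `P ∋ p`, so `P` lies over `(p) ⊂ ℤ` as well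
  have hpP : (p : 𝓞 K) ∈ P := by
    have h1 : (p : 𝓞 ℚ) ∈ P.under (𝓞 ℚ) := by rw [← hP.over]; exact hpv
    rw [under_def, mem_comap, map_natCast] at h1
    exact h1
  have hpbot : span {(p : ℤ)} ≠ ⊥ := by
    rw [ne_eq, span_singleton_eq_bot]
    exact_mod_cast hp.ne_zero
  haveI hPZ : P.LiesOver (span {(p : ℤ)}) := by
    haveI hmax : (span {(p : ℤ)}).IsMaximal :=
      ((span_singleton_prime (by exact_mod_cast hp.ne_zero)).mpr hp').isMaximal hpbot
    refine ⟨hmax.eq_of_le (comap_ne_top _ (Ideal.IsPrime.ne_top inferInstance)) ?_⟩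
    rw [span_singleton_le_iff_mem, mem_comap, map_natCast]
    exact hpP
  have heZ : P.ramificationIdx ℤ = 1 := hZ P hPZ
  -- both indices are the old `ramificationIdx'` of the extended ideal `p·𝓞 K`
  haveI := hP
  rw [← Ideal.ramificationIdx'_eq_ramificationIdx v.asIdeal P v.ne_bot]
  rw [← Ideal.ramificationIdx'_eq_ramificationIdx (span {(p : ℤ)}) P hpbot] at heZ
  have hmapQ : v.asIdeal.map (algebraMap (𝓞 ℚ) (𝓞 K)) = span {(p : 𝓞 K)} := by
    rw [← span_natCast_rat_eq hp hpv, Ideal.map_span, Set.image_singleton, map_natCast]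
  have hmapZ : (span {(p : ℤ)}).map (algebraMap ℤ (𝓞 K)) = span {(p : 𝓞 K)} := by
    rw [Ideal.map_span, Set.image_singleton, map_natCast]
  unfold Ideal.ramificationIdx' at heZ ⊢
  rw [hmapQ]
  rw [hmapZ] at heZ
  exact heZ

end Unramified

/-! ### §2 `K ∩ ℚ(E[p]) = ℚ` on a Heegner frame with `p ∤ d_K`: `ρ̄_{E,p}(Γ_K) = ρ̄_{E,p}(Γ_ℚ)` -/

section Frame

variable (W : WeierstrassCurve ℚ) [W.IsElliptic] {K : Type u} [Field K] [NumberField K] {p : ℕ}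
  [Fact p.Prime]

/-- **On a Heegner frame with `p ∤ d_K`, `K` is unramified wherever `E[p]` may ramify**: at every finite
place `v` of `ℚ`, either `K/ℚ` is unramified at `v`, or `E = W` has good reduction at `v` and `v ∤ p`. The primes
`q ∣ N_E` split in `K` (Heegner hypothesis, `X11b.isUnramifiedIn_of_satisfiesHeegnerHypothesis_of_dvd`), `p ∤ d_K`
is unramified (§1), every other prime is of good reduction (`hasGoodReductionAt_of_not_dvd_conductorNorm`). File F
(`X9/LeafDischargeKolyvaginCebotarev`) has the same with «`p` split» in place of «`p ∤ d_K`»; this is Gross's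
«`D` prime to `Np`». [cite: GrossLMS1991, §9 (PDF p. 227, before Prop. 9.1)] -/
theorem forall_isUnramifiedIn_or_hasGoodReductionAt_of_heegner_of_not_dvd_discr (hK : IsImaginaryQuadratic K)
    (hHN : SatisfiesHeegnerHypothesis (W.conductorNorm ℤ) K) (hnd : ¬ (p : ℤ) ∣ NumberField.discr K) :
    ∀ v : HeightOneSpectrum (𝓞 ℚ), Algebra.IsUnramifiedIn (𝓞 K) v.asIdeal ∨
      (W.HasGoodReductionAt v ∧ (p : 𝓞 ℚ) ∉ v.asIdeal) := by
  have hp : p.Prime := Fact.out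
  intro v
  obtain ⟨ℓ, hℓ, hℓv⟩ := exists_prime_natCast_mem v
  by_cases hℓN : ℓ ∣ W.conductorNorm ℤ
  · exact Or.inl
      (Summit.BirchSwinnertonDyer.Rank1Residual.X11b.isUnramifiedIn_of_satisfiesHeegnerHypothesis_of_dvd
        hK hHN hℓ hℓN v hℓv)
  by_cases hℓp : ℓ = p
  · refine Or.inl (isUnramifiedIn_of_not_dvd_discr hp hnd v ?_)
    rw [← hℓp]
    exact hℓv
  · right
    have hv : v = (Rat.HeightOneSpectrum.primesEquiv (R := 𝓞 ℚ)).symm ⟨ℓ, hℓ⟩ :=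
      (natCast_mem_asIdeal_iff_eq_primesEquiv_symm v hℓ).mp hℓv
    have hpe : (Rat.HeightOneSpectrum.primesEquiv (R := 𝓞 ℚ) v : ℕ) = ℓ := by
      rw [hv, Equiv.apply_symm_apply]
    exact ⟨hasGoodReductionAt_of_not_dvd_conductorNorm W v (by rw [hpe]; exact hℓN),
      not_natCast_mem_of_prime_ne hℓ hp hℓp v hℓv⟩

/-- **`ρ̄_{E,p}(Γ_K) = ρ̄_{E,p}(Γ_ℚ)` on a Heegner frame with `p ∤ d_K`** (Gross 1991 §9: *"the numberfields `K`
and `ℚ(E_p)` are disjoint"*): every `γ ∈ Γ_ℚ` acts on `E(ℚ̄)[p]` as some `g ∈ Γ_K` does — the tree's Minkowski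
argument `JetchevIrreducibleCebotarev.forall_exists_absGaloisRestrict_smul_eq_of_unramified` (Serre 1972 §5.4) fed
with `forall_isUnramifiedIn_or_hasGoodReductionAt_of_heegner_of_not_dvd_discr`. No hypothesis on the image.
[cite: GrossLMS1991, §9 (PDF p. 227, before Prop. 9.1)] [cite: Serre1972, §5.4 (proof of Prop. 21)] -/
theorem forall_exists_absGaloisRestrict_smul_eq_of_heegner_of_not_dvd_discr (hK : IsImaginaryQuadratic K)
    (hHN : SatisfiesHeegnerHypothesis (W.conductorNorm ℤ) K) (hnd : ¬ (p : ℤ) ∣ NumberField.discr K) :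
    ∀ γ : absoluteGaloisGroup ℚ, ∃ g : absoluteGaloisGroup K,
      ∀ P : geomTorsion W p, absGaloisRestrict ℚ K g • P = γ • P :=
  forall_exists_absGaloisRestrict_smul_eq_of_unramified W hK.1
    (forall_isUnramifiedIn_or_hasGoodReductionAt_of_heegner_of_not_dvd_discr W hK hHN hnd)

/-! ### §3 The homothety: a scalar `a ≢ 1 (mod p)` realised by `Γ_K` on `E_K[p]` -/

/-- **(Z) over `K` on a Heegner frame with `p ∤ d_K`, `p` odd, `E[p]` irreducible over `ℚ`**: some `z ∈ Γ_K`
acts on `E_K(K̄)[p]` as an integer scalar `a` with `p ∤ a − 1` — the homothety Howard's H.2 / Lawson–Wuthrich's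
Lemma 3 consume. Over `ℚ` it is `−1` at surjective image or `p = 3` and Serre's §2.6 homothety otherwise (tree
`JetchevIrreducibleCebotarev.exists_smul_eq_smul_of_irreducible`); it is moved to `Γ_K` by §2 (tree
`…exists_smul_eq_smul_baseChange_of_irreducible`). [cite: Serre1972, §2.4 Prop. 15 and §2.6]
[cite: GrossLMS1991, Prop. 9.1 (the homothety)] [cite: LawsonWuthrich2016, Lemma 4] -/
theorem exists_smul_eq_zsmul_baseChange_of_heegner_of_not_dvd_discr (hK : IsImaginaryQuadratic K)
    (hHN : SatisfiesHeegnerHypothesis (W.conductorNorm ℤ) K) (hnd : ¬ (p : ℤ) ∣ NumberField.discr K)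
    (hp2 : p ≠ 2) (hirr : W.HasIrreducibleModPGaloisRep p) :
    ∃ (z : absoluteGaloisGroup K) (a : ℤ), ¬ (p : ℤ) ∣ a - 1 ∧
      ∀ P : geomTorsion (W.baseChange K) p, z • P = a • P :=
  exists_smul_eq_smul_baseChange_of_irreducible W hp2 hirr
    (forall_exists_absGaloisRestrict_smul_eq_of_heegner_of_not_dvd_discr W hK hHN hnd)

end Frame

/-! ### §3′/§4 On the frames of the shared μ-letter: `Thm413Hypotheses N W K p κ γ` + `(irr_ℚ)` -/

section Letter

variable {N : ℕ} {W : WeierstrassCurve ℚ} [W.IsGloballyMinimal] {K : Type u} [Field K] [NumberField K]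
  {p : ℕ} [Fact p.Prime] {κ : ZpExtension K p} {γ : absoluteGaloisGroup K}

/-- **The homothety on the frames of the rows-9/10 μ-letter.** Under the standing hypotheses of
Castella–Grossi–Lee–Skinner 2022 Thm. 4.1.3 (`Thm413Hypotheses N W K p κ γ`: `E` elliptic of conductor `N`, `p ∤ 2`,
`K` imaginary quadratic with `p ∤ d_K`, Heegner hypothesis for `N`, …) together with `(irr_ℚ)`, some `z ∈ Γ_K` acts
on `E_K[p]` as an integer scalar `a` with `p ∤ a − 1`. No hypothesis on the splitting of `p`, on the class number,
or on the image beyond `(irr_ℚ)`; every odd `p`. [cite: CastellaGrossiLeeSkinner2022, §3.2 standing hypotheses]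
[cite: Serre1972, §2.6] [cite: GrossLMS1991, §9 and Prop. 9.1] -/
theorem exists_smul_eq_zsmul_of_thm413Hypotheses
    (hyp : CastellaGrossiLeeSkinner2022.Thm413Hypotheses N W K p κ γ)
    (hirr : W.HasIrreducibleModPGaloisRep p) :
    ∃ (z : absoluteGaloisGroup K) (a : ℤ), ¬ (p : ℤ) ∣ a - 1 ∧
      ∀ P : geomTorsion (W.baseChange K) p, z • P = a • P := by
  haveI := hyp.isElliptic
  have hHN : SatisfiesHeegnerHypothesis (W.conductorNorm ℤ) K := hyp.level ▸ hyp.heegner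
  exact exists_smul_eq_zsmul_baseChange_of_heegner_of_not_dvd_discr W hyp.isImaginaryQuadratic hHN
    hyp.not_dvd_discr hyp.p_ne_two hirr

/-- **Howard's H.2 on the frames of the rows-9/10 μ-letter, layer form — UNCONDITIONAL.** Under
`Thm413Hypotheses N W K p κ γ` + `(irr_ℚ)`: for every `b m`, every `j ≤ m + 1` and every open normal `U ⊴ Γ_K`
with `Γ_{K(E[p^{m+1}])} ⊓ κ⁻¹(p^b ℤ_p) ≤ U` — i.e. `U = Gal(K̄/L)` for a finite Galois `L ⊆ K_b(E_K[p^{m+1}])`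
inside `K_∞(E[p^∞])`, `κ` the letter's anticyclotomic `ℤ_p`-extension — the restriction
`H¹(Γ_K, E_K[p^j]) → H¹(U, E_K[p^j])` is injective: `H¹(Gal(L/K), E(L)[p^j]) = 0`. This is hypothesis H.2 of
Howard 2004 §2.3 in the form his Lemma 2.6.2 consumes, with the homothety of
`LawsonWuthrich2016.subgroupResKer_geomTorsion_eq_bot_of_homothety_layer` supplied by
`exists_smul_eq_zsmul_of_thm413Hypotheses`. [cite: Howard2004HeegnerKolyvagin, §2.3 hypothesis H.2 and Lemma 2.6.2]
[cite: LawsonWuthrich2016, Lemma 3, Lemma 4] -/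
theorem subgroupResKer_geomTorsion_eq_bot_of_thm413Hypotheses
    (hyp : CastellaGrossiLeeSkinner2022.Thm413Hypotheses N W K p κ γ)
    (hirr : W.HasIrreducibleModPGaloisRep p) (b : ℕ) {m j : ℕ} (hj : j ≤ m + 1)
    (U : Subgroup (absoluteGaloisGroup K)) [U.Normal] (hU : IsOpen (U : Set (absoluteGaloisGroup K)))
    (hle : torsionFixing (W.baseChange K) ((p : ℤ) ^ (m + 1)) ⊓ κ.layerSubgroup b ≤ U) :
    subgroupResKer (geomTorsion (W.baseChange K) ((p : ℤ) ^ j)) U = ⊥ := by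
  haveI := hyp.isElliptic
  obtain ⟨z, a, ha, hz⟩ := exists_smul_eq_zsmul_of_thm413Hypotheses hyp hirr
  exact LawsonWuthrich2016.subgroupResKer_geomTorsion_eq_bot_of_homothety_layer (W.baseChange K) hz ha κ b
    hj U hU hle

/-- **Howard's H.2 on the letter's frames, `K_∞`-form**: the same for every open normal `U ⊴ Γ_K` with
`Γ_{K(E[p^{m+1}])} ⊓ Gal(K̄/K_∞) ≤ U` (`U = Gal(K̄/L)`, `L ⊆ K_∞(E_K[p^{m+1}])` finite Galois over `K`).
[cite: Howard2004HeegnerKolyvagin, §2.3 hypothesis H.2 and Lemma 2.6.2; proof of Prop. 3.1.3]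
[cite: LawsonWuthrich2016, Lemma 3] -/
theorem subgroupResKer_geomTorsion_eq_bot_of_thm413Hypotheses_ker
    (hyp : CastellaGrossiLeeSkinner2022.Thm413Hypotheses N W K p κ γ)
    (hirr : W.HasIrreducibleModPGaloisRep p) {m j : ℕ} (hj : j ≤ m + 1)
    (U : Subgroup (absoluteGaloisGroup K)) [U.Normal] (hU : IsOpen (U : Set (absoluteGaloisGroup K)))
    (hle : torsionFixing (W.baseChange K) ((p : ℤ) ^ (m + 1)) ⊓ κ.kerSubgroup ≤ U) :
    subgroupResKer (geomTorsion (W.baseChange K) ((p : ℤ) ^ j)) U = ⊥ := by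
  haveI := hyp.isElliptic
  obtain ⟨z, a, ha, hz⟩ := exists_smul_eq_zsmul_of_thm413Hypotheses hyp hirr
  exact LawsonWuthrich2016.subgroupResKer_geomTorsion_eq_bot_of_homothety_ker (W.baseChange K) hz ha κ hj U
    hU hle

/-- **Howard's H.2 on the letter's frames, `E[p]`-coefficients** (Howard's `T̄ = E_K[p]`): restriction
`H¹(K, E_K[p]) → H¹(L, E_K[p])` is injective for every finite Galois `L ⊆ K_b(E_K[p^{m+1}])` — exactly the
injectivity used in the Čebotarev step, Howard's Lemma 2.6.2.
[cite: Howard2004HeegnerKolyvagin, §2.3 hypothesis H.2 and Lemma 2.6.2] [cite: LawsonWuthrich2016, Lemma 3] -/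
theorem subgroupResKer_geomTorsion_prime_eq_bot_of_thm413Hypotheses
    (hyp : CastellaGrossiLeeSkinner2022.Thm413Hypotheses N W K p κ γ)
    (hirr : W.HasIrreducibleModPGaloisRep p) (b m : ℕ)
    (U : Subgroup (absoluteGaloisGroup K)) [U.Normal] (hU : IsOpen (U : Set (absoluteGaloisGroup K)))
    (hle : torsionFixing (W.baseChange K) ((p : ℤ) ^ (m + 1)) ⊓ κ.layerSubgroup b ≤ U) :
    subgroupResKer (geomTorsion (W.baseChange K) (p : ℤ)) U = ⊥ := by
  haveI := hyp.isElliptic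
  obtain ⟨z, a, ha, hz⟩ := exists_smul_eq_zsmul_of_thm413Hypotheses hyp hirr
  exact LawsonWuthrich2016.subgroupResKer_geomTorsion_prime_eq_bot_of_homothety_layer (W.baseChange K) hz ha
    κ b m U hU hle

end Letter

/-! ### §5 On the X9 leaf frames of files F/G (`ClassX9`, Heegner for `N_E`, `p` split) -/

section X9

variable {W : WeierstrassCurve ℚ} [W.IsElliptic] [W.IsGloballyMinimal] {p : ℕ} [Fact p.Prime]

/-- **Howard's H.2 on the X9 Heegner frames** (`Rank1Residual.ClassX9 W p`: `p ≥ 5` good ordinary, `E[p]`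
irreducible, `ρ̄_{E,p}` not onto; `K` imaginary quadratic with the Heegner hypothesis for `N_E` and `p` split;
any `ℤ_p`-extension `κ` of `K`): `ker (H¹(Γ_K, E_K[p^j]) → H¹(U, E_K[p^j])) = 0` for every open normal
`U ⊇ Γ_{K(E[p^{m+1}])} ⊓ κ⁻¹(p^b ℤ_p)`, `j ≤ m + 1` — the homothety is file F's
`ClassX9.kolyvaginImage_scalar_of_heegner`. [cite: Howard2004HeegnerKolyvagin, §2.3 hypothesis H.2 and Lemma 2.6.2]
[cite: LawsonWuthrich2016, Lemma 3, Lemma 4] -/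
theorem subgroupResKer_geomTorsion_eq_bot_of_classX9_heegner
    (h : Literature.NumberTheory.EllipticCurves.Rank1Residual.ClassX9 W p) {K : Type u} [Field K]
    [NumberField K] (hK : IsImaginaryQuadratic K) (hHN : SatisfiesHeegnerHypothesis (W.conductorNorm ℤ) K)
    (hHp : SatisfiesHeegnerHypothesis p K) (κ : ZpExtension K p) (b : ℕ) {m j : ℕ} (hj : j ≤ m + 1)
    (U : Subgroup (absoluteGaloisGroup K)) [U.Normal] (hU : IsOpen (U : Set (absoluteGaloisGroup K)))
    (hle : torsionFixing (W.baseChange K) ((p : ℤ) ^ (m + 1)) ⊓ κ.layerSubgroup b ≤ U) :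
    subgroupResKer (geomTorsion (W.baseChange K) ((p : ℤ) ^ j)) U = ⊥ := by
  obtain ⟨z, a, ha, hz⟩ := h.kolyvaginImage_scalar_of_heegner hK hHN hHp
  exact LawsonWuthrich2016.subgroupResKer_geomTorsion_eq_bot_of_homothety_layer (W.baseChange K) hz ha κ b
    hj U hU hle

/-- **Howard's H.2 on the X9 Heegner frames, with `p ∤ d_K` in place of «`p` split»** (the frames of the
deciding crux's letter carry `p ∤ d_K` through `Thm413Hypotheses`; here read directly off `ClassX9`):
`ker (H¹(Γ_K, E_K[p^j]) → H¹(U, E_K[p^j])) = 0` for every open normal `U ⊇ Γ_{K(E[p^{m+1}])} ⊓ κ⁻¹(p^b ℤ_p)`,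
`j ≤ m + 1`. [cite: Howard2004HeegnerKolyvagin, §2.3 hypothesis H.2 and Lemma 2.6.2]
[cite: LawsonWuthrich2016, Lemma 3, Lemma 4] -/
theorem subgroupResKer_geomTorsion_eq_bot_of_classX9_of_not_dvd_discr
    (h : Literature.NumberTheory.EllipticCurves.Rank1Residual.ClassX9 W p) {K : Type u} [Field K]
    [NumberField K] (hK : IsImaginaryQuadratic K) (hHN : SatisfiesHeegnerHypothesis (W.conductorNorm ℤ) K)
    (hnd : ¬ (p : ℤ) ∣ NumberField.discr K) (κ : ZpExtension K p) (b : ℕ) {m j : ℕ} (hj : j ≤ m + 1)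
    (U : Subgroup (absoluteGaloisGroup K)) [U.Normal] (hU : IsOpen (U : Set (absoluteGaloisGroup K)))
    (hle : torsionFixing (W.baseChange K) ((p : ℤ) ^ (m + 1)) ⊓ κ.layerSubgroup b ≤ U) :
    subgroupResKer (geomTorsion (W.baseChange K) ((p : ℤ) ^ j)) U = ⊥ := by
  obtain ⟨z, a, ha, hz⟩ := exists_smul_eq_zsmul_baseChange_of_heegner_of_not_dvd_discr W hK hHN hnd
    h.ne_two h.irr
  exact LawsonWuthrich2016.subgroupResKer_geomTorsion_eq_bot_of_homothety_layer (W.baseChange K) hz ha κ b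
    hj U hU hle

end X9

end Summit.BirchSwinnertonDyer.BirchSwinnertonDyer.Theorems.HeegnerMuPartHowardH2

end
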